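import Literature.Combinatorics.SimpleGraph.ReducedDivisors
import Mathlib.Combinatorics.SimpleGraph.Connectivity.Subgraph
import HarnessLib

/-!
# `G`-parking functions: it suffices to test connected subsets
# (Benson–Chakrabarty–Tetali 2010, Proposition 2.1)

Source (held, read at the page; statements VERBATIM). B. Benson, D. Chakrabarty, P. Tetali,
*`G`-parking functions, acyclic orientations and spanning trees*, Discrete Math. 310 (2010)
1340–1353 [BensonChakrabartyTetali2010] (held text `paper:arxiv-0801.1114`, chunk p0004):
«**Definition 2.1.** For a connected graph `G`, a `G`-parking function relative to vertex
`q ∈ V` is a function `f : V \ {q} → ℤ_{≥0}` such that for every non-empty set `A ⊆ V(G) \ {q}`,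
there exists `v ∈ A` such that `f(v) < d_Ā(v)`, where `d_Ā(v)` denotes the number of edges
`e = vw` with `w ∉ A`. **Proposition 2.1.** If for a function `f : V(G) \ {q} → ℤ_{≥0}`, for every
non-empty connected subgraph `A ⊆ G \ {q}`, there exists `v ∈ V(A)` such that `f(v) < d_Ā(v)`,
then `f` is a `G`-parking function. Assume that, for all connected `A ⊆ G \ {q}`, that there exists
`v ∈ V(A)` such that `f(v) < d_Ā(v)`. Proceeding by contradiction, suppose that there is some
disconnected `B ⊆ G \ {q}` such that `f(v) ≥ d_B̄(v)` for every `v ∈ V(B)`. Consider then any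
connected component `C` of `B`. Since `C` is connected we have, by the hypothesis of the
proposition, that `f(v) < d_C̄(v)`, for some vertex `v` in `C`. Thus `d_B̄(v) < d_C̄(v)`, implying
that there is a vertex `u` in `C̄ \ B̄` such that `v` and `u` are connected by an edge in `G`;
otherwise, either `f(v) ≥ d_C̄(v)` or `f(v) < d_B̄(v)`. This contradicts the choice of `C`.»

## What is formalised (vocabulary: `IsReduced G q D` of `ReducedDivisors` — B–N's `q`-reduced
## divisors, i.e. `G`-parking functions relative to `q`, with `d_Ā(v) = |N(v) \ A|`; «connected
## subgraph `A`» is Mathlib's `(G.induce A).Connected`)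

* `exists_connected_part` — the «connected component `C` of `B`» used in the proof: every
  non-empty `B` contains a non-empty `C` with `G[C]` connected and no edge from `C` to `B \ C`,
  so that `d_C̄ = d_B̄` on `C` (`C` = the vertices reachable from a fixed `v₀ ∈ B` inside `B`);
* **Proposition 2.1** `isReduced_of_forall_connected` and the resulting characterisation
  **`isReduced_iff_forall_connected`** (the defining condition need only be checked on connected
  `A ∌ q`).

Theorems only; no `sorry`; no named facts.
-/

open Finset SimpleGraph

namespace Literature.Combinatorics.SimpleGraph.BakerNorine

variable {V : Type*} [Fintype V] [DecidableEq V] {G : SimpleGraph V} [DecidableRel G.Adj]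

/-- **The connected component used in the proof of Proposition 2.1**: a non-empty vertex set `B`
contains a non-empty `C ⊆ B` inducing a connected subgraph and closed under `B`-neighbours, so
that `d_C̄(v) = d_B̄(v)` for `v ∈ C` («Consider then any connected component `C` of `B` […]
otherwise […] there is a vertex `u` in `C̄ \ B̄` such that `v` and `u` are connected by an edge»).
[cite: BensonChakrabartyTetali2010, Proposition 2.1 (proof)] -/
theorem exists_connected_part {B : Finset V} (hB : B.Nonempty) :
    ∃ C : Finset V, C.Nonempty ∧ C ⊆ B ∧ (G.induce (C : Set V)).Connected ∧
      ∀ v ∈ C, G.neighborFinset v \ C = G.neighborFinset v \ B := by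
  classical
  obtain ⟨v₀, hv₀⟩ := hB
  -- `C`: the vertices of `B` reachable from `v₀` by a walk inside `B`
  set C : Finset V := B.filter fun v => ∃ p : G.Walk v₀ v, ∀ x ∈ p.support, x ∈ B with hC
  have hmemC : ∀ v, v ∈ C ↔ v ∈ B ∧ ∃ p : G.Walk v₀ v, ∀ x ∈ p.support, x ∈ B := fun v => by
    rw [hC, mem_filter]
  have hv₀C : v₀ ∈ C := by
    refine (hmemC v₀).2 ⟨hv₀, Walk.nil, fun x hx => ?_⟩
    rw [Walk.support_nil, List.mem_singleton] at hx
    exact hx ▸ hv₀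
  -- closure under `B`-neighbours
  have hclosed : ∀ v ∈ C, ∀ w ∈ B, G.Adj v w → w ∈ C := fun v hv w hw hvw => by
    obtain ⟨-, p, hp⟩ := (hmemC v).1 hv
    refine (hmemC w).2 ⟨hw, p.concat hvw, fun x hx => ?_⟩
    rw [Walk.support_concat, List.mem_append, List.mem_singleton] at hx
    rcases hx with hx | rfl
    · exact hp x hx
    · exact hw
  refine ⟨C, ⟨v₀, hv₀C⟩, filter_subset _ _, ?_, fun v hv => ?_⟩
  · -- `G[C]` is connected: patch together the supports of the defining walks
    refine induce_connected_of_patches v₀ (mem_coe.2 hv₀C) fun {v} hv => ?_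
    obtain ⟨-, p, hp⟩ := (hmemC v).1 (mem_coe.1 hv)
    refine ⟨{x | x ∈ p.support}, fun x hx => mem_coe.2 ((hmemC x).2 ⟨hp x hx, p.takeUntil x hx,
      fun y hy => hp y (p.support_takeUntil_subset_support hx hy)⟩),
      p.start_mem_support, p.end_mem_support, ?_⟩
    exact p.connected_induce_support.preconnected _ _
  · -- no edge leaves `C` inside `B`
    ext w
    simp only [mem_sdiff, mem_neighborFinset]
    constructor
    · rintro ⟨hvw, hwC⟩
      exact ⟨hvw, fun hwB => hwC (hclosed v hv w hwB hvw)⟩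
    · rintro ⟨hvw, hwB⟩
      exact ⟨hvw, fun hwC => hwB (filter_subset _ _ hwC)⟩

/-- **Proposition 2.1.** «If for a function `f : V(G) \ {q} → ℤ_{≥0}`, for every non-empty
connected subgraph `A ⊆ G \ {q}`, there exists `v ∈ V(A)` such that `f(v) < d_Ā(v)`, then `f` is a
`G`-parking function.» (Nonnegativity off `q` is part of the source's `f : V \ {q} → ℤ_{≥0}`.)
[cite: BensonChakrabartyTetali2010, Proposition 2.1] -/
theorem isReduced_of_forall_connected {q : V} {D : V → ℤ} (h0 : ∀ v, v ≠ q → 0 ≤ D v)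
    (h : ∀ A : Finset V, A.Nonempty → q ∉ A → (G.induce (A : Set V)).Connected →
      ∃ v ∈ A, D v < #(G.neighborFinset v \ A)) :
    IsReduced G q D := by
  refine ⟨h0, fun B hB hqB => ?_⟩
  obtain ⟨C, hCne, hCB, hconn, hout⟩ := exists_connected_part (G := G) hB
  obtain ⟨v, hvC, hlt⟩ := h C hCne (fun hq => hqB (hCB hq)) hconn
  exact ⟨v, hCB hvC, by rwa [hout v hvC] at hlt⟩

/-- Hence the defining condition of a `G`-parking function need only be tested on the non-empty
connected `A ∌ q`. [cite: BensonChakrabartyTetali2010, Proposition 2.1 (with Definition 2.1)] -/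
theorem isReduced_iff_forall_connected {q : V} {D : V → ℤ} :
    IsReduced G q D ↔ (∀ v, v ≠ q → 0 ≤ D v) ∧
      ∀ A : Finset V, A.Nonempty → q ∉ A → (G.induce (A : Set V)).Connected →
        ∃ v ∈ A, D v < #(G.neighborFinset v \ A) :=
  ⟨fun hD => ⟨hD.1, fun A hA hqA _ => hD.2 A hA hqA⟩,
    fun h => isReduced_of_forall_connected h.1 h.2⟩

end Literature.Combinatorics.SimpleGraph.BakerNorine
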